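import Summits.RiemannHypothesis.RiemannHypothesis.Theorems.PfPersistenceMarkovCoreRigidity
import Summits.RiemannHypothesis.RiemannHypothesis.Theorems.PfPersistenceMarkovCorePositivity
import HarnessLib

/-!
# PF persistence (theory 1, edge law): THE MARKOV CORE OF A NON-NEGATIVE WEIGHT TABLE, IV —
# KERNEL PERRON–FROBENIUS FOR CORE GROUND STATES, and ζ's core at every window

Helper file (`--supports stmt-RiemannHypothesis-19953`); mechanism/rigidity campaign; no RH claims.
Last of four files.  For EVERY weight table `w` with `w n ≥ 0` on the prime index of the window and
EVERY window `a > 0` (objects in `PfPersistenceMarkovCore`):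

* `IsCoreGround.norm` — Beurling–Deny: `|u|` is a core ground state with `u`;
* `IsCoreGround.ae_pos` — POSITIVITY: `|u| > 0` a.e. on `(-a, a)`;
* `IsCoreGround.phase` — PHASE RIGIDITY: `u = γ|u|` a.e., `|γ| = 1`; hence a real-valued core ground
  state is a.e. `≥ 0` or a.e. `≤ 0` — it never changes sign (`IsCoreGround.oneSigned_of_real`);
* `IsCoreGround.unique` — SIMPLICITY: two core ground states differ a.e. by a constant phase;
* `IsCoreGround.even` — EVENNESS: `u(−x) = u(x)` a.e.;
* `IsCoreGround.exists_pos_even_rep` — STRUCTURE: every core ground state is `γΦ` a.e. with `Φ`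
  everywhere even, `> 0` on `(-a, a)`, `0` off `[-a, a]`, itself a core ground state;
* `coreBottom_zetaTable`, `exists_isCoreGround_zetaTable`, `zetaTable_corePerronFrobenius` — for ζ's
  table the core bottom is the tree's `inf Q₀ + M_a` over window tests and a core ground state EXISTS
  at every window (route WeilGroundState's `exists_markovMinimizer`, Connes–Consani–Moscovici
  compactness), so the above is non-vacuous for ζ.

So, in the cell's language: for the pole-free Markov block of every non-negative table at every
window the channels (I) (interior sign change of the ground state) and (M) (degenerate bottom) are
EMPTY — proved, RH-free, with no operator, resolvent or boundary hypothesis.  What is NOT addressed: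
the boundary behaviour of the core ground state at `±a` (a Hopf-type statement for the kernel
`ρ ~ 1/(2|t|)`), and anything about the full form with its rank-two polar term (not Markovian: the
finite model `Literature.Analysis.Matrix.exists_zMatrix_add_rankOne_groundState_boundary_zero`).

## References

* M. Reed, B. Simon, *Methods of Modern Mathematical Physics IV* (1978), §XIII.12, Thms XIII.43–44.
* Z.-Q. Chen, M. Fukushima, *Symmetric Markov Processes, Time Change, and Boundary Theory* (2012),
  §1.1 Def. 1.1.2, Thm 1.1.3(e) (normal contractions operate on a Dirichlet form).
* E. H. Lieb, M. Loss, *Analysis*, 2nd ed. (2001), Thm 7.8 (convexity of the energy in the density).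
* E. Bombieri, Rend. Mat. Acc. Lincei (9) 11 (2000) 183–233, Thm 2 (the windowed explicit formula).
* A. Connes, C. Consani, H. Moscovici, *Zeta zeros and prolate wave operators: semilocal adelic
  operators* (2025), Thm 3.6 (compactness; used only through the tree's `exists_markovMinimizer`).
-/

set_option linter.dupNamespace false

noncomputable section

open MeasureTheory Set Filter
open scoped Topology ENNReal NNReal ComplexConjugate

namespace Summit.RiemannHypothesis.RiemannHypothesis.Theorems.PfPersistence

open Literature.NumberTheory.LFunctions
open Summit.RiemannHypothesis.RiemannHypothesis.Theorems.WeilWindowFlowWindowLipschitz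
  (stub_localizedCut_aesm_weilIncrement)
open Summit.RiemannHypothesis.RiemannHypothesis.Theorems.WeilGroundStateMarkovPart
open Summit.RiemannHypothesis.RiemannHypothesis.Theorems.PfPersistenceDownCone (zetaTable)

/-! ## §7 Core ground states: the packaged Perron–Frobenius theorem -/

/-- A core ground state with a pointwise-supported a.e.-equal function: the latter is a core ground
state too (the energy and the class only see a.e. classes). [folklore] -/
theorem IsCoreGround.congr_ae {a : ℝ} {w : ℕ → ℝ} {u v : ℝ → ℂ} (hu : IsCoreGround w a u)
    (huv : u =ᵐ[volume] v) (hvs : ∀ x, x ∉ Icc (-a) a → v x = 0) : IsCoreGround w a v := by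
  refine ⟨hu.1.congr_ae huv hvs, ?_, ?_⟩
  · rw [← hu.2.1]
    exact integral_congr_ae (huv.mono fun x hx ↦ by simp [hx])
  · rw [← tableDirichletEnergy_congr_ae a w huv]
    exact hu.2.2

/-- A measurable representative of a core ground state that vanishes POINTWISE off the window and is
again a core ground state. [folklore] -/
theorem IsCoreGround.exists_measurable {a : ℝ} {w : ℕ → ℝ} {u : ℝ → ℂ} (hu : IsCoreGround w a u) :
    ∃ v : ℝ → ℂ, Measurable v ∧ v =ᵐ[volume] u ∧ IsCoreGround w a v := by
  set v : ℝ → ℂ := (Icc (-a) a).indicator (hu.1.1.1.mk u) with hvdef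
  have hvu : v =ᵐ[volume] u := by
    filter_upwards [hu.1.1.1.ae_eq_mk] with x h1
    by_cases hx : x ∈ Icc (-a) a
    · rw [hvdef, indicator_of_mem hx]; exact h1.symm
    · rw [hvdef, indicator_of_notMem hx, hu.1.2.1 x hx]
  have hvm : Measurable v :=
    hu.1.1.1.stronglyMeasurable_mk.measurable.indicator measurableSet_Icc
  exact ⟨v, hvm, hvu, hu.congr_ae hvu.symm fun x hx ↦ indicator_of_notMem hx _⟩

/-- The energy of a core ground state bounds `E = coreBottom` in the shape the rigidity lemmas use. [folklore] -/
theorem IsCoreGround.energy_le {a : ℝ} {w : ℕ → ℝ} {u : ℝ → ℂ} (hu : IsCoreGround w a u) :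
    tableDirichletEnergy a w u ≤ coreBottom w a :=
  hu.2.2.le

/-- `coreBottom_mul_le` in the shape the rigidity lemmas use. [folklore] -/
theorem coreBottom_bot {a : ℝ} {w : ℕ → ℝ} (hw : ∀ n ∈ weilPrimeIndex a, 0 ≤ w n) :
    ∀ v : ℝ → ℂ, MemLp v 2 → (∀ x, x ∉ Icc (-a) a → v x = 0) →
      IntegrableOn (fun t ↦ weilArchDensity t * weilIncrement v t) (Ioi 0) →
      coreBottom w a * ∫ x, ‖v x‖ ^ 2 ≤ tableDirichletEnergy a w v :=
  fun _ hv hvs hfin ↦ coreBottom_mul_le hw ⟨hv, hvs, hfin⟩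

/-- **Beurling–Deny for core ground states**: the modulus of a core ground state is a core ground
state. [cite: ChenFukushima2012, §1.1 Def. 1.1.2 and Thm. 1.1.3(e)] -/
theorem IsCoreGround.norm {a : ℝ} {w : ℕ → ℝ} (hw : ∀ n ∈ weilPrimeIndex a, 0 ≤ w n) {u : ℝ → ℂ}
    (hu : IsCoreGround w a u) : IsCoreGround w a (fun x ↦ ((‖u x‖ : ℝ) : ℂ)) := by
  have hn : ∫ x, ‖((‖u x‖ : ℝ) : ℂ)‖ ^ 2 = 1 := by
    rw [← hu.2.1]
    exact integral_congr_ae (Eventually.of_forall fun x ↦ by simp)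
  refine ⟨hu.1.norm, hn, le_antisymm ?_ (coreBottom_le hw hu.1.norm hn)⟩
  rw [← hu.2.2]
  exact tableDirichletEnergy_norm_le hw hu.1.1 hu.1.2.2

/-- **Positivity of core ground states**: `|u| > 0` a.e. on the open window (`a > 0`, non-negative
table). [cite: ReedSimonIV1978, §XIII.12 Thm XIII.44] -/
theorem IsCoreGround.ae_pos {a : ℝ} {w : ℕ → ℝ} (hw : ∀ n ∈ weilPrimeIndex a, 0 ≤ w n)
    (ha : 0 < a) {u : ℝ → ℂ} (hu : IsCoreGround w a u) :
    ∀ᵐ x : ℝ, x ∈ Ioo (-a) a → 0 < ‖u x‖ := by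
  obtain ⟨v, hvm, hvu, hv⟩ := hu.exists_measurable
  have hΨ := hv.norm hw
  set Ψ : ℝ → ℝ := fun x ↦ ‖v x‖ with hΨdef
  have hΨL : MemLp Ψ 2 := hv.1.1.norm
  have hΨn : ∫ x, Ψ x ^ 2 = 1 := hv.2.1
  have hpos : ∀ᵐ x : ℝ, x ∈ Ioo (-a) a → 0 < Ψ x :=
    core_nonneg_minimizer_ae_pos hw ha hvm.norm (fun x ↦ norm_nonneg _) hΨL
      (fun x hx ↦ by simp [hΨdef, hv.1.2.1 x hx]) hΨn hΨ.1.2.2 hΨ.energy_le (coreBottom_bot hw)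
  filter_upwards [hpos, hvu] with x hx hxe hxI
  have h' : 0 < ‖v x‖ := hx hxI
  rwa [hxe] at h'

/-- **Phase rigidity of core ground states**: `u = γ|u|` a.e. for a constant `|γ| = 1`. [cite: ReedSimonIV1978, §XIII.12 Thm XIII.44] -/
theorem IsCoreGround.phase {a : ℝ} {w : ℕ → ℝ} (hw : ∀ n ∈ weilPrimeIndex a, 0 ≤ w n)
    (ha : 0 < a) {u : ℝ → ℂ} (hu : IsCoreGround w a u) :
    ∃ γ : ℂ, ‖γ‖ = 1 ∧ u =ᵐ[volume] fun x ↦ γ * ((‖u x‖ : ℝ) : ℂ) := by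
  obtain ⟨v, hvm, hvu, hv⟩ := hu.exists_measurable
  have hvpos : ∀ᵐ x : ℝ, x ∈ Ioo (-a) a → 0 < ‖v x‖ := hv.ae_pos hw ha
  obtain ⟨γ, hγ, hvγ⟩ := core_phase_rigidity hw ha hvm hv.1.1 hv.1.2.1 hv.2.1 hv.1.2.2
    hv.energy_le (coreBottom_bot hw) hvpos
  refine ⟨γ, hγ, ?_⟩
  filter_upwards [hvu, hvγ] with x h1 h2
  rw [← h1]
  exact h2

/-- **A real-valued core ground state never changes sign**: it is a.e. `≥ 0` or a.e. `≤ 0` (phase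
rigidity with a real phase `γ = ±1`). This is the cell's channel (I) (interior sign change) and, with
`IsCoreGround.unique`, channel (M) (loss of one-signedness through a degenerate bottom) for the Markov
core of EVERY non-negative table at EVERY window: both are empty. [cite: ReedSimonIV1978, §XIII.12 Thm XIII.44] -/
theorem IsCoreGround.oneSigned_of_real {a : ℝ} {w : ℕ → ℝ} (hw : ∀ n ∈ weilPrimeIndex a, 0 ≤ w n)
    (ha : 0 < a) {f : ℝ → ℝ} (hu : IsCoreGround w a (fun x ↦ (f x : ℂ))) :
    (∀ᵐ x : ℝ, 0 ≤ f x) ∨ (∀ᵐ x : ℝ, f x ≤ 0) := by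
  obtain ⟨γ, hγ, hfγ⟩ := hu.phase hw ha
  have hpos : ∀ᵐ x : ℝ, x ∈ Ioo (-a) a → 0 < ‖(f x : ℂ)‖ := hu.ae_pos hw ha
  have hfγ' : ∀ᵐ x : ℝ, (f x : ℂ) = γ * ((|f x| : ℝ) : ℂ) := by
    filter_upwards [hfγ] with x hx
    rw [hx, Complex.norm_real, Real.norm_eq_abs]
  -- at a point of the window where `f ≠ 0` the phase is `± 1`
  have hvol : volume (Ioo (-a) a) ≠ 0 := by
    rw [Real.volume_Ioo]
    exact (ENNReal.ofReal_pos.2 (by linarith)).ne'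
  obtain ⟨x₀, hx₀, hx₀e⟩ : ∃ x₀, f x₀ ≠ 0 ∧ (f x₀ : ℂ) = γ * ((|f x₀| : ℝ) : ℂ) := by
    by_contra hne
    refine hvol (measure_eq_zero_iff_ae_notMem.2 ?_)
    filter_upwards [hpos, hfγ'] with x h1 h2 hxI
    have h3 : f x ≠ 0 := by
      have := h1 hxI
      rw [Complex.norm_real, Real.norm_eq_abs, abs_pos] at this
      exact this
    exact hne ⟨x, h3, h2⟩
  have h0 : (f x₀ : ℂ) ≠ 0 := by exact_mod_cast hx₀
  rcases lt_or_gt_of_ne hx₀ with hneg | hposx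
  · -- `γ = -1`
    have hγ1 : γ = -1 := by
      rw [abs_of_neg hneg] at hx₀e
      push_cast at hx₀e
      have h1 : (γ + 1) * (f x₀ : ℂ) = 0 := by linear_combination hx₀e
      have h2 := (mul_eq_zero.1 h1).resolve_right h0
      linear_combination h2
    right
    filter_upwards [hfγ'] with x hx
    rw [hγ1] at hx
    have h2 : ((f x : ℝ) : ℂ) = ((-|f x| : ℝ) : ℂ) := by
      rw [hx]
      push_cast
      ring
    have h3 : f x = -|f x| := by exact_mod_cast h2
    rw [h3]
    exact neg_nonpos.2 (abs_nonneg _)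
  · -- `γ = 1`
    have hγ1 : γ = 1 := by
      rw [abs_of_pos hposx] at hx₀e
      have h1 : (γ - 1) * (f x₀ : ℂ) = 0 := by linear_combination (-1 : ℂ) * hx₀e
      have h2 := (mul_eq_zero.1 h1).resolve_right h0
      linear_combination h2
    left
    filter_upwards [hfγ'] with x hx
    rw [hγ1, one_mul] at hx
    have h3 : f x = |f x| := by exact_mod_cast hx
    rw [h3]
    exact abs_nonneg _

/-- **Simplicity of the core bottom**: two core ground states of the same non-negative table on the
same window differ a.e. by a constant phase. [cite: ReedSimonIV1978, §XIII.12 Thm XIII.44] -/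
theorem IsCoreGround.unique {a : ℝ} {w : ℕ → ℝ} (hw : ∀ n ∈ weilPrimeIndex a, 0 ≤ w n)
    (ha : 0 < a) {u₁ u₂ : ℝ → ℂ} (h₁ : IsCoreGround w a u₁) (h₂ : IsCoreGround w a u₂) :
    ∃ γ : ℂ, ‖γ‖ = 1 ∧ u₁ =ᵐ[volume] fun x ↦ γ * u₂ x := by
  obtain ⟨v, hvm, hvu, hv⟩ := h₂.exists_measurable
  have hΨ := hv.norm hw
  set Ψ : ℝ → ℝ := fun x ↦ ‖v x‖ with hΨdef
  have hΨL : MemLp Ψ 2 := hv.1.1.norm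
  have hΨn : ∫ x, Ψ x ^ 2 = 1 := hv.2.1
  have hΨs : ∀ x, x ∉ Icc (-a) a → Ψ x = 0 := fun x hx ↦ by simp [hΨdef, hv.1.2.1 x hx]
  have hpos : ∀ᵐ x : ℝ, x ∈ Ioo (-a) a → 0 < Ψ x :=
    core_nonneg_minimizer_ae_pos hw ha hvm.norm (fun x ↦ norm_nonneg _) hΨL hΨs hΨn hΨ.1.2.2
      hΨ.energy_le (coreBottom_bot hw)
  -- `u₁ = γ₁ Ψ`
  obtain ⟨w₁, hw₁m, hw₁u, hw₁⟩ := h₁.exists_measurable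
  obtain ⟨γ₁, hγ₁, h₁γ⟩ : ∃ γ : ℂ, ‖γ‖ = 1 ∧ w₁ =ᵐ[volume] fun x ↦ γ * (Ψ x : ℂ) := by
    -- uniqueness of the non-negative minimiser + phase rigidity for `w₁`
    have hΨ₁ := hw₁.norm hw
    have hΦΨ : (fun x ↦ ‖w₁ x‖) =ᵐ[volume] Ψ :=
      core_nonneg_minimizer_ae_eq hw hw₁m.norm hvm.norm (fun x ↦ norm_nonneg _)
        (fun x ↦ norm_nonneg _) hw₁.1.1.norm hΨL (fun x hx ↦ by simp [hw₁.1.2.1 x hx]) hΨs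
        hw₁.2.1 hΨn hΨ₁.1.2.2 hΨ.1.2.2 hΨ₁.energy_le hΨ.energy_le (coreBottom_bot hw)
    obtain ⟨γ, hγ, hwγ⟩ := core_phase_rigidity hw ha hw₁m hw₁.1.1 hw₁.1.2.1 hw₁.2.1 hw₁.1.2.2
      hw₁.energy_le (coreBottom_bot hw) (hw₁.ae_pos hw ha)
    refine ⟨γ, hγ, ?_⟩
    filter_upwards [hwγ, hΦΨ] with x h1 h2
    rw [h1, ← h2]
  -- `v = γ₂ Ψ`
  obtain ⟨γ₂, hγ₂, h₂γ⟩ := core_phase_rigidity hw ha hvm hv.1.1 hv.1.2.1 hv.2.1 hv.1.2.2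
    hv.energy_le (coreBottom_bot hw) (hv.ae_pos hw ha)
  have hγ₂0 : γ₂ ≠ 0 := fun h ↦ by simp [h] at hγ₂
  refine ⟨γ₁ / γ₂, by rw [norm_div, hγ₁, hγ₂, div_one], ?_⟩
  filter_upwards [hw₁u, h₁γ, hvu, h₂γ] with x e1 e2 e3 e4
  simp only [hΨdef] at e2
  rw [← e1, e2]
  conv_rhs => rw [← e3, e4]
  rw [← mul_assoc, div_mul_cancel₀ γ₁ hγ₂0]

/-- **Evenness of core ground states**: `u(−x) = u(x)` a.e. [cite: ReedSimonIV1978, §XIII.12 Thm XIII.44] -/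
theorem IsCoreGround.even {a : ℝ} {w : ℕ → ℝ} (hw : ∀ n ∈ weilPrimeIndex a, 0 ≤ w n)
    (ha : 0 < a) {u : ℝ → ℂ} (hu : IsCoreGround w a u) :
    u =ᵐ[volume] fun x ↦ u (-x) := by
  obtain ⟨v, hvm, hvu, hv⟩ := hu.exists_measurable
  have hΨ := hv.norm hw
  set Ψ : ℝ → ℝ := fun x ↦ ‖v x‖ with hΨdef
  have hΨs : ∀ x, x ∉ Icc (-a) a → Ψ x = 0 := fun x hx ↦ by simp [hΨdef, hv.1.2.1 x hx]
  have heven : Ψ =ᵐ[volume] fun x ↦ Ψ (-x) :=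
    core_nonneg_minimizer_even hw hvm.norm (fun x ↦ norm_nonneg _) hv.1.1.norm hΨs hv.2.1
      hΨ.1.2.2 hΨ.energy_le (coreBottom_bot hw)
  obtain ⟨γ, hγ, hvγ⟩ := core_phase_rigidity hw ha hvm hv.1.1 hv.1.2.1 hv.2.1 hv.1.2.2
    hv.energy_le (coreBottom_bot hw) (hv.ae_pos hw ha)
  have hneg := (Measure.measurePreserving_neg (volume : Measure ℝ)).quasiMeasurePreserving
  have hvγ' : (fun x ↦ v (-x)) =ᵐ[volume] fun x ↦ γ * ((‖v (-x)‖ : ℝ) : ℂ) :=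
    hneg.ae_eq_comp hvγ
  have hvu' : (fun x ↦ v (-x)) =ᵐ[volume] fun x ↦ u (-x) := hneg.ae_eq_comp hvu
  filter_upwards [hvu, hvγ, hvγ', hvu', heven] with x e1 e2 e3 e4 e5
  rw [← e1, ← e4, e2, e3]
  simp only [hΨdef] at e5
  rw [e5]

/-- **The structure theorem for core ground states.** Every core ground state of a non-negative table
on a window `a > 0` is, a.e. and up to a constant phase `|γ| = 1`, an everywhere EVEN real function,
STRICTLY POSITIVE on `(-a, a)` and zero off `[-a, a]`, which is itself a core ground state. [cite: ReedSimonIV1978, §XIII.12 Thm XIII.44] -/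
theorem IsCoreGround.exists_pos_even_rep {a : ℝ} {w : ℕ → ℝ} (hw : ∀ n ∈ weilPrimeIndex a, 0 ≤ w n)
    (ha : 0 < a) {u : ℝ → ℂ} (hu : IsCoreGround w a u) :
    ∃ Φ : ℝ → ℝ, ∃ γ : ℂ, ‖γ‖ = 1 ∧ (∀ x, Φ (-x) = Φ x) ∧ (∀ x ∈ Ioo (-a) a, 0 < Φ x) ∧
      (∀ x, x ∉ Icc (-a) a → Φ x = 0) ∧ IsCoreGround w a (fun x ↦ (Φ x : ℂ)) ∧
      u =ᵐ[volume] fun x ↦ γ * (Φ x : ℂ) := by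
  classical
  have hΨ := hu.norm hw
  set Ψ : ℝ → ℝ := fun x ↦ ‖u x‖ with hΨdef
  have hΨs : ∀ x, x ∉ Icc (-a) a → Ψ x = 0 := fun x hx ↦ by simp [hΨdef, hu.1.2.1 x hx]
  have hpos : ∀ᵐ x : ℝ, x ∈ Ioo (-a) a → 0 < Ψ x := hu.ae_pos hw ha
  have heven : Ψ =ᵐ[volume] fun x ↦ Ψ (-x) := by
    have h := hΨ.even hw ha
    filter_upwards [h] with x hx
    simpa [hΨdef] using hx
  obtain ⟨f, hfeven, hfpos, hfΨ⟩ := exists_even_pos_rep hΨs hpos heven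
  set Φ : ℝ → ℝ := (Icc (-a) a).indicator f with hΦdef
  have hIcc : ∀ x, (-x ∈ Icc (-a) a) ↔ (x ∈ Icc (-a) a) := fun x ↦ by
    constructor <;> rintro ⟨h1, h2⟩ <;> exact ⟨by linarith, by linarith⟩
  have hΦeven : ∀ x, Φ (-x) = Φ x := fun x ↦ by
    by_cases hx : x ∈ Icc (-a) a
    · rw [hΦdef, indicator_of_mem hx, indicator_of_mem ((hIcc x).2 hx), hfeven]
    · rw [hΦdef, indicator_of_notMem hx, indicator_of_notMem (fun h ↦ hx ((hIcc x).1 h))]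
  have hΦpos : ∀ x ∈ Ioo (-a) a, 0 < Φ x := fun x hx ↦ by
    rw [hΦdef, indicator_of_mem (Ioo_subset_Icc_self hx)]
    exact hfpos x hx
  have hΦs : ∀ x, x ∉ Icc (-a) a → Φ x = 0 := fun x hx ↦ indicator_of_notMem hx _
  have hΦΨ : Φ =ᵐ[volume] Ψ := by
    filter_upwards [hfΨ] with x hx
    by_cases hxI : x ∈ Icc (-a) a
    · rw [hΦdef, indicator_of_mem hxI, hx]
    · rw [hΦdef, indicator_of_notMem hxI, hΨs x hxI]
  have hΦΨc : (fun x ↦ ((Ψ x : ℝ) : ℂ)) =ᵐ[volume] fun x ↦ (Φ x : ℂ) :=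
    hΦΨ.mono fun x hx ↦ by
      show ((Ψ x : ℝ) : ℂ) = (Φ x : ℂ)
      rw [hx]
  have hΦg : IsCoreGround w a (fun x ↦ (Φ x : ℂ)) :=
    hΨ.congr_ae hΦΨc fun x hx ↦ by simp [hΦs x hx]
  obtain ⟨γ, hγ, huγ⟩ := hu.phase hw ha
  refine ⟨Φ, γ, hγ, hΦeven, hΦpos, hΦs, hΦg, ?_⟩
  filter_upwards [huγ, hΦΨ] with x h1 h2
  rw [h1, h2]

/-! ## §8 ζ's table: the bottom is the tree's, and a core ground state exists -/

/-- For ζ's table the core bottom on the finite-energy class equals the tree's bottom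
`inf Q₀ + M_a` over window test functions (route WeilGroundState's density theorem
`bottom_mul_le_of_finiteEnergy`: window tests are a form core). [cite: FukushimaOshimaTakeda2011, §1.4 Example 1.4.1] -/
theorem coreBottom_zetaTable {a : ℝ} (ha : 0 < a) :
    coreBottom zetaTable a =
      sInf {x : ℝ | ∃ h : ℝ → ℂ, IsWeilTest h ∧ tsupport h ⊆ Icc (-a) a ∧
        ∫ t, ‖h t‖ ^ 2 = (1 : ℝ) ∧ x = weilMarkovQuadratic h} + weilMarkovConstant a := by
  set E : ℝ := sInf {x : ℝ | ∃ h : ℝ → ℂ, IsWeilTest h ∧ tsupport h ⊆ Icc (-a) a ∧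
    ∫ t, ‖h t‖ ^ 2 = (1 : ℝ) ∧ x = weilMarkovQuadratic h} + weilMarkovConstant a with hEdef
  have hEtest : ∀ h : ℝ → ℂ, IsWeilTest h → tsupport h ⊆ Icc (-a) a →
      E * ∫ x, ‖h x‖ ^ 2 ≤ weilDirichletEnergy a h := fun h hh hhs ↦
    bottom_mul_le_weilDirichletEnergy hh hhs
  have hbot : ∀ v : ℝ → ℂ, MemLp v 2 → (∀ x, x ∉ Icc (-a) a → v x = 0) →
      IntegrableOn (fun t ↦ weilArchDensity t * weilIncrement v t) (Ioi 0) →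
      E * ∫ x, ‖v x‖ ^ 2 ≤ weilDirichletEnergy a v := fun v hv hvs hvf ↦
    bottom_mul_le_of_finiteEnergy ha hEtest hv hvs hvf
  refine le_antisymm ?_ ?_
  · -- a minimiser of the tree has energy `≤ E`
    obtain ⟨u₀, hu₀, hu₀s, hu₀n, hu₀f, hu₀E⟩ := exists_markovMinimizer ha
    set v₀ : ℝ → ℂ := (Icc (-a) a).indicator (hu₀.1.mk u₀) with hv₀def
    have hv₀u : v₀ =ᵐ[volume] u₀ := by
      filter_upwards [hu₀.1.ae_eq_mk, hu₀s] with x h1 h2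
      by_cases hx : x ∈ Icc (-a) a
      · rw [hv₀def, indicator_of_mem hx]; exact h1.symm
      · rw [hv₀def, indicator_of_notMem hx, h2 hx]
    have hv₀ : coreAdm a v₀ := by
      refine ⟨hu₀.ae_eq hv₀u.symm, fun x hx ↦ indicator_of_notMem hx _, ?_⟩
      rw [weilIncrement_congr_ae hv₀u]
      exact hu₀f
    have hv₀n : ∫ x, ‖v₀ x‖ ^ 2 = 1 := by
      rw [← hu₀n]; exact integral_congr_ae (hv₀u.mono fun x hx ↦ by simp [hx])
    calc coreBottom zetaTable a ≤ tableDirichletEnergy a zetaTable v₀ :=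
          coreBottom_le (fun n _ ↦ PfPersistenceDownCone.zetaTable_nonneg n) hv₀ hv₀n
      _ = weilDirichletEnergy a u₀ := by
          rw [tableDirichletEnergy_zetaTable, weilDirichletEnergy_congr_ae a hv₀u]
      _ ≤ E := hu₀E
  · refine le_csInf (coreSet_nonempty zetaTable ha) ?_
    rintro _ ⟨f, hf, hn, rfl⟩
    have := hbot f hf.1 hf.2.1 hf.2.2
    rw [hn, mul_one] at this
    rwa [tableDirichletEnergy_zetaTable]

/-- **ζ's Markov core has a ground state on every window** (so §7 is non-vacuous for ζ): the tree's
minimiser `exists_markovMinimizer` (Connes–Consani–Moscovici compactness), made pointwise supported.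
[cite: ConnesConsaniMoscovici2025, Thm 3.6] -/
theorem exists_isCoreGround_zetaTable {a : ℝ} (ha : 0 < a) : ∃ u : ℝ → ℂ, IsCoreGround zetaTable a u := by
  obtain ⟨u₀, hu₀, hu₀s, hu₀n, hu₀f, hu₀E⟩ := exists_markovMinimizer ha
  set v₀ : ℝ → ℂ := (Icc (-a) a).indicator (hu₀.1.mk u₀) with hv₀def
  have hv₀u : v₀ =ᵐ[volume] u₀ := by
    filter_upwards [hu₀.1.ae_eq_mk, hu₀s] with x h1 h2
    by_cases hx : x ∈ Icc (-a) a
    · rw [hv₀def, indicator_of_mem hx]; exact h1.symm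
    · rw [hv₀def, indicator_of_notMem hx, h2 hx]
  have hv₀ : coreAdm a v₀ := by
    refine ⟨hu₀.ae_eq hv₀u.symm, fun x hx ↦ indicator_of_notMem hx _, ?_⟩
    rw [weilIncrement_congr_ae hv₀u]
    exact hu₀f
  have hv₀n : ∫ x, ‖v₀ x‖ ^ 2 = 1 := by
    rw [← hu₀n]; exact integral_congr_ae (hv₀u.mono fun x hx ↦ by simp [hx])
  have hz : ∀ n ∈ weilPrimeIndex a, 0 ≤ zetaTable n := fun n _ ↦
    PfPersistenceDownCone.zetaTable_nonneg n
  refine ⟨v₀, hv₀, hv₀n, le_antisymm ?_ (coreBottom_le hz hv₀ hv₀n)⟩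
  rw [coreBottom_zetaTable ha, tableDirichletEnergy_zetaTable, weilDirichletEnergy_congr_ae a hv₀u]
  exact hu₀E

/-- **Perron–Frobenius for ζ's Markov core at every window, packaged**: a core ground state exists,
and every core ground state is `γΦ` a.e. with `|γ| = 1` and `Φ` even, `> 0` on `(-a, a)`, zero off
`[-a, a]`. (The cell's channels (I) and (M) for ζ's own pole-free block: empty, PROVED, RH-free.)
[cite: ReedSimonIV1978, §XIII.12 Thm XIII.44] -/
theorem zetaTable_corePerronFrobenius {a : ℝ} (ha : 0 < a) :
    (∃ u : ℝ → ℂ, IsCoreGround zetaTable a u) ∧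
      ∀ u : ℝ → ℂ, IsCoreGround zetaTable a u →
        ∃ Φ : ℝ → ℝ, ∃ γ : ℂ, ‖γ‖ = 1 ∧ (∀ x, Φ (-x) = Φ x) ∧ (∀ x ∈ Ioo (-a) a, 0 < Φ x) ∧
          (∀ x, x ∉ Icc (-a) a → Φ x = 0) ∧ IsCoreGround zetaTable a (fun x ↦ (Φ x : ℂ)) ∧
          u =ᵐ[volume] fun x ↦ γ * (Φ x : ℂ) :=
  ⟨exists_isCoreGround_zetaTable ha, fun _ hu ↦
    hu.exists_pos_even_rep (fun n _ ↦ PfPersistenceDownCone.zetaTable_nonneg n) ha⟩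

end Summit.RiemannHypothesis.RiemannHypothesis.Theorems.PfPersistence

end
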